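import Literature.NumberTheory.Automorphic.UnitaryGroupSingularLineArchSmooth
import HarnessLib

/-!
# The singular line function `t ↦ ∫_{𝔸_E} ∫_K f(k⁻¹ (u(x)⁻¹ (γ₀ n(θ t)) u(x)) k) dμK dμX` of `U(J₃)` is a Schwartz–Bruhat function
# on `𝔸_F`
(Rogawski, *Automorphic Representations of Unitary Groups in Three Variables* (1990), §7.2, proof of Prop. 7.2.2, pp. 94–95: the
function `ψ(w) = ∫_{𝔸_E} f^K(u(x)⁻¹ γ n(w) u(x)) dx` on the centre line `w = t δ₀` is fed into the Tate integral of Lemma 7.1.1 over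
the ideles of `F`; Weil, *Basic Number Theory*, Ch. VII §2)

Topic `NumberTheory/Automorphic`; namespace `Literature.NumberTheory.Automorphic.UnitaryGroup`. THEOREMS ONLY over accepted tree modules
(no definition, no named fact, no instance, no notation, no `sorry`). FILE 2 of the row (L5-iii-c) binder (hSB⁻) of the LAW 5 road of
`Cruxes/H413/Lines/F0_T1InnerFormTraceIdentity.lean` (cell `pub/hodgecm-mathlib`, crux H413); letters of FILE 1 ★
`UnitaryGroupSingularLineArchSmooth` (`u`, `n`, `γ₀ = ι(d(a,b,a))`, `θ = traceZeroLine F E c hcδ hδ`, `K`, `μK`, `μX`, `f`).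

* **`singularLine_kAverage_mem_schwartzBruhatAdele`** — the line function lies in `Meyer.schwartzBruhatAdele F`: Weil's criterion ★
  `Meyer.mem_schwartzBruhatAdele_of_level (K := F)` with (a) support and (hcs) from ★ `exists_isCompact_singularKernel_conj_support`, (b) the
  level from the tube lemma ★ `exists_levelIdeal_forall_conj_center_traceZeroLine_mem` (`θ` additive, `n(w + w′) = n(w) n(w′)` central, the
  conjugates `k⁻¹ n(θ(0,δ′)) k` have trivial archimedean part and lie in the finite level of `f`), (c) = ★ `contDiff_singularLine_kAverage`.
* `integral_integral_singularLine_kAverage_swap` (Fubini `∫_{𝔸_E} ∫_K = ∫_K ∫_{𝔸_E}`) and the primed head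
  `singularLine_kAverage_mem_schwartzBruhatAdele'` in the order `t ↦ ∫_K ψ_k(θ t) dμK`.

## References

* J. D. Rogawski, *Automorphic Representations of Unitary Groups in Three Variables*, Ann. of Math. Stud. 123 (1990), §7.2
  Prop. 7.2.2 (pp. 94–95) [Rogawski1990].
* A. Weil, *Basic Number Theory*, Grundlehren 144 (1967), Ch. VII §2 [WeilBNT1967].
-/

set_option autoImplicit false

noncomputable section

open MeasureTheory NumberField NumberField.mixedEmbedding IsDedekindDomain Set Topology Filter Function
-- `Classical` is needed to see the Mathlib normed-space instances on `mixedSpace E` (note H5 of `AdelicGLnGlue`)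
open scoped ContDiff Classical MatrixGroups Matrix

namespace Literature.NumberTheory.Automorphic

namespace UnitaryGroup

-- the Banach algebra structure of `M_n(K_∞)` through which `IsArchSmooth` is defined
open scoped Matrix.Norms.Operator

variable {F E : Type} [Field F] [NumberField F] [Field E] [NumberField E] [Algebra F E] {c : E ≃ₐ[F] E}

/-! ## The singular line function is a Schwartz–Bruhat function on `𝔸_F` -/

section Assembly

variable [Algebra.IsQuadraticExtension F E] {δ : E}
  [MeasurableSpace (AdeleRing (𝓞 E) E)] [BorelSpace (AdeleRing (𝓞 E) E)]
  {KU : Subgroup (quasiSplit F E c 3).Adelic} [MeasurableSpace KU] [BorelSpace KU]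

/-- **`ψ^K ∘ θ ∈ 𝒮(𝔸_F)`** (Rogawski (1990), proof of Prop. 7.2.2, pp. 94–95: the singular line function, `K`-average inside, read on
`𝔸_F` through the centre line `θ`). For `f ∈ C_c^∞(U(J₃)(𝔸_F))` (★ `IsQuasiSplitTest`), `K ≤ G(𝔸_F)` compact with a finite Borel
measure `μK`, a Haar measure `μX` on `𝔸_E` and the singular base point `γ₀ = ι(d(a,b,a))`, `a ≠ b`:
`t ↦ ∫_{𝔸_E} ∫_K f(k⁻¹ (u(x)⁻¹ (γ₀ n(θ t)) u(x)) k) dμK dμX ∈ Meyer.schwartzBruhatAdele F`. Weil's criterion ★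
`Meyer.mem_schwartzBruhatAdele_of_level (K := F)`: (a)+(hcs) support from `exists_isCompact_singularKernel_conj_support`; (b) the level —
`θ` additive, `n(w + w′) = n(w) n(w′)` central (★ `heisChart_zero_mul`, ★ `commute_center_coe_unipotentInBorel`), the conjugates
`k⁻¹ n(θ(0,δ′)) k` have trivial archimedean part and lie in the finite level of `f` for `δ′ ∈ 𝔫𝒪̂_F` (tube lemma
`exists_levelIdeal_forall_conj_center_traceZeroLine_mem`); (c) = `contDiff_singularLine_kAverage`.
[cite: Rogawski1990, §7.2 (pp. 94–95)] [cite: WeilBNT1967, Ch. VII §2, Def. 2 and Prop. 2] -/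
theorem singularLine_kAverage_mem_schwartzBruhatAdele (hc : c * c = 1) (hcδ : c δ = -δ) (hδ : δ ≠ 0) {a b : Eˣ}
    (hab : (a : E) ≠ (b : E)) {g₀ : (quasiSplit F E c 3).Rational} {γ₀ : (quasiSplit F E c 3).arithmeticSubgroup}
    (hg₀ : ((g₀.val : GL (Fin 3) E) : Matrix (Fin 3) (Fin 3) E) = !![(a : E), 0, 0; 0, b, 0; 0, 0, a])
    (hγ₀ : (γ₀ : (quasiSplit F E c 3).Adelic) = (quasiSplit F E c 3).toAdelic g₀)
    (μX : Measure (AdeleRing (𝓞 E) E)) [μX.IsAddHaarMeasure] (hK : IsCompact (KU : Set (quasiSplit F E c 3).Adelic))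
    (μK : Measure KU) [IsFiniteMeasure μK] {f : (quasiSplit F E c 3).Adelic → ℂ} (hf : IsQuasiSplitTest F E c 3 f) :
    (fun t : AdeleRing (𝓞 F) F =>
      ∫ x : AdeleRing (𝓞 E) E, (∫ k, f ((k : (quasiSplit F E c 3).Adelic)⁻¹ *
        ((((heisElt hc x (0 : traceZeroAdele F E c) : unipotentInBorel F E c 3) : borelAdelic F E c 3) :
              (quasiSplit F E c 3).Adelic)⁻¹ *
          ((γ₀ : (quasiSplit F E c 3).Adelic) *
            (((heisElt hc 0 (traceZeroLine F E c hcδ hδ t) : unipotentInBorel F E c 3) : borelAdelic F E c 3) :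
              (quasiSplit F E c 3).Adelic)) *
          (((heisElt hc x (0 : traceZeroAdele F E c) : unipotentInBorel F E c 3) : borelAdelic F E c 3) :
              (quasiSplit F E c 3).Adelic)) * k) ∂μK) ∂μX) ∈ Meyer.schwartzBruhatAdele F := by
  have hsm := contDiff_singularLine_kAverage hc hcδ hδ hab hg₀ hγ₀ μX hK μK hf
  obtain ⟨η₁, η₂, hη₁, hη₂, hfη⟩ := hf
  have hη : IsSmoothKernelGL 3 E (fun z => (η₁ z : ℂ) + (η₂ z : ℂ) * Complex.I) := isSmoothKernelGL_of_isTestFunctionGL_pair hη₁ hη₂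
  have hfc : HasCompactSupport f := by
    have h : f = (fun z => (η₁ z : ℂ) + (η₂ z : ℂ) * Complex.I) ∘ adelicVal F E c 3 _ := funext hfη
    rw [h]
    have hcl : IsClosed ((adelic F E c 3 ((StdForm.antidiagonal 3).over E) : Subgroup (GL (Fin 3) (AdeleRing (𝓞 E) E))) :
        Set (GL (Fin 3) (AdeleRing (𝓞 E) E))) := isClosed_unitaryGroupOfForm_conjAdele F E c _
    exact hη.hasCompactSupport.comp_isClosedEmbedding hcl.isClosedEmbedding_subtypeVal
  set uA : AdeleRing (𝓞 E) E → (quasiSplit F E c 3).Adelic := fun x =>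
    (((heisElt hc x (0 : traceZeroAdele F E c) : unipotentInBorel F E c 3) : borelAdelic F E c 3) : (quasiSplit F E c 3).Adelic)
    with huA
  set nA : traceZeroAdele F E c → (quasiSplit F E c 3).Adelic := fun w =>
    (((heisElt hc 0 w : unipotentInBorel F E c 3) : borelAdelic F E c 3) : (quasiSplit F E c 3).Adelic) with hnA
  -- the `K`-average kernel `Φ g := ∫ k, f (k⁻¹ g k) dμK` and the line function `Ψ t := ∫ Φ (u(x)⁻¹ (γ₀ n((traceZeroLine F E c hcδ hδ) t)) u(x)) dμX`
  set Ψ : AdeleRing (𝓞 F) F → ℂ := fun t => ∫ x : AdeleRing (𝓞 E) E, (∫ k, f ((k : (quasiSplit F E c 3).Adelic)⁻¹ *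
      ((uA x)⁻¹ * ((γ₀ : (quasiSplit F E c 3).Adelic) * nA ((traceZeroLine F E c hcδ hδ) t)) * uA x) * k) ∂μK) ∂μX with hΨdef
  -- (a)/(hcs): supports
  obtain ⟨X_c, hX_c, W_c, hW_c, hXW⟩ := exists_isCompact_singularKernel_conj_support hc hab hg₀ hγ₀ hK hfc
  have hΨ0 : ∀ t, Ψ t ≠ 0 → t ∈ (traceZeroLine F E c hcδ hδ).symm '' W_c := by
    intro t ht
    by_contra hnot
    apply ht
    have h0 : ∀ (x : AdeleRing (𝓞 E) E) (k : KU), f ((k : (quasiSplit F E c 3).Adelic)⁻¹ *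
        ((uA x)⁻¹ * ((γ₀ : (quasiSplit F E c 3).Adelic) * nA ((traceZeroLine F E c hcδ hδ) t)) * uA x) * (k : (quasiSplit F E c 3).Adelic)) = 0 := by
      intro x k
      by_contra hne
      exact hnot ⟨(traceZeroLine F E c hcδ hδ) t, (hXW k k.2 x ((traceZeroLine F E c hcδ hδ) t) hne).2, (traceZeroLine F E c hcδ hδ).symm_apply_apply t⟩
    show (∫ x : AdeleRing (𝓞 E) E, (∫ k, f ((k : (quasiSplit F E c 3).Adelic)⁻¹ *
      ((uA x)⁻¹ * ((γ₀ : (quasiSplit F E c 3).Adelic) * nA ((traceZeroLine F E c hcδ hδ) t)) * uA x) * k) ∂μK) ∂μX) = 0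
    simp_rw [h0, integral_zero]
  have hTc : IsCompact ((traceZeroLine F E c hcδ hδ).symm '' W_c) := hW_c.image (traceZeroLine F E c hcδ hδ).symm.continuous
  -- (b): the level along the centre line
  obtain ⟨U, hU, hηU⟩ := hη.exists_level
  obtain ⟨U₀, hU₀o, -, rfl⟩ := hU
  set Uo : Set (quasiSplit F E c 3).Adelic := {v | GLn.sndHom 3 E (adelicVal F E c 3 _ v) ∈ U₀} with hUo
  have hUoo : IsOpen Uo := hU₀o.preimage (GLn.continuous_sndHom.comp continuous_subtype_val)
  have hUo1 : (1 : (quasiSplit F E c 3).Adelic) ∈ Uo := by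
    show GLn.sndHom 3 E (adelicVal F E c 3 _ 1) ∈ U₀
    rw [map_one, map_one]
    exact U₀.one_mem
  obtain ⟨𝔫, -, h𝔫⟩ := exists_levelIdeal_forall_conj_center_traceZeroLine_mem hc hcδ hδ hK hUoo hUo1
  have hlevel : ∀ δ' ∈ levelIdeal F 𝔫, ∀ (k : KU) (g : (quasiSplit F E c 3).Adelic),
      f ((k : (quasiSplit F E c 3).Adelic)⁻¹ * (g * nA ((traceZeroLine F E c hcδ hδ) ((((0 : InfiniteAdeleRing F), δ') : AdeleRing (𝓞 F) F)))) *
        (k : (quasiSplit F E c 3).Adelic)) =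
        f ((k : (quasiSplit F E c 3).Adelic)⁻¹ * g * (k : (quasiSplit F E c 3).Adelic)) := by
    intro δ' hδ' k g
    set n' := nA ((traceZeroLine F E c hcδ hδ) ((((0 : InfiniteAdeleRing F), δ') : AdeleRing (𝓞 F) F))) with hn'
    have hsplit : (k : (quasiSplit F E c 3).Adelic)⁻¹ * (g * n') * (k : (quasiSplit F E c 3).Adelic) =
        ((k : (quasiSplit F E c 3).Adelic)⁻¹ * g * (k : (quasiSplit F E c 3).Adelic)) *
          ((k : (quasiSplit F E c 3).Adelic)⁻¹ * n' * (k : (quasiSplit F E c 3).Adelic)) := by group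
    have hmem : adelicVal F E c 3 _ ((k : (quasiSplit F E c 3).Adelic)⁻¹ * n' * (k : (quasiSplit F E c 3).Adelic)) ∈ U₀.map (GLn.ofFinite 3 E) := by
      have hf' : GLn.sndHom 3 E (adelicVal F E c 3 _ ((k : (quasiSplit F E c 3).Adelic)⁻¹ * n' * (k : (quasiSplit F E c 3).Adelic))) ∈ U₀ := h𝔫 δ' hδ' k k.2
      have hinf : GLn.toMixed 3 E (adelicVal F E c 3 _ ((k : (quasiSplit F E c 3).Adelic)⁻¹ * n' * (k : (quasiSplit F E c 3).Adelic))) = 1 := by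
        have h0 : archHom E (((traceZeroLine F E c hcδ hδ) ((((0 : InfiniteAdeleRing F), δ') : AdeleRing (𝓞 F) F)) : traceZeroAdele F E c) :
            AdeleRing (𝓞 E) E) = 0 := by
          rw [archHom_apply]
          show InfiniteAdeleRing.ringEquiv_mixedSpace E (InfiniteAdeleRing.baseChange F E 0 *
            (algebraMap E (AdeleRing (𝓞 E) E) δ).1) = 0
          rw [map_zero, zero_mul, map_zero]
        have hnv : ((GLn.toMixed 3 E (adelicVal F E c 3 _ n') : GL (Fin 3) (mixedSpace E)) : Matrix (Fin 3) (Fin 3) (mixedSpace E)) = 1 := by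
          have h := coe_toMixed_adelicVal_heisChart_zero hc
            (traceZeroLine F E c hcδ hδ ((((0 : InfiniteAdeleRing F), δ') : AdeleRing (𝓞 F) F)))
          rw [h0, Matrix.single_zero, add_zero] at h
          exact h
        have hn1 : GLn.toMixed 3 E (adelicVal F E c 3 _ n') = 1 := Units.ext hnv
        simp only [map_mul, map_inv, hn1, mul_one, inv_mul_cancel]
      rw [Subgroup.mem_map]
      refine ⟨GLn.sndHom 3 E (adelicVal F E c 3 _ ((k : (quasiSplit F E c 3).Adelic)⁻¹ * n' * (k : (quasiSplit F E c 3).Adelic))), hf', ?_⟩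
      have hX := GLn.ofInfinite_toMixed_mul_ofFinite_sndHom (adelicVal F E c 3 _ ((k : (quasiSplit F E c 3).Adelic)⁻¹ * n' * (k : (quasiSplit F E c 3).Adelic)))
      rw [hinf, map_one, one_mul] at hX
      exact hX
    rw [hsplit, hfη, hfη ((k : (quasiSplit F E c 3).Adelic)⁻¹ * g * (k : (quasiSplit F E c 3).Adelic)),
      map_mul (adelicVal F E c 3 _) ((k : (quasiSplit F E c 3).Adelic)⁻¹ * g * (k : (quasiSplit F E c 3).Adelic))
        ((k : (quasiSplit F E c 3).Adelic)⁻¹ * n' * (k : (quasiSplit F E c 3).Adelic))]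
    exact hηU _ hmem _
  have hinv : ∀ (ti : InfiniteAdeleRing F) (y : FiniteAdeleRing (𝓞 F) F), ∀ δ' ∈ levelIdeal F 𝔫,
      Ψ (ti, y + δ') = Ψ (ti, y) := by
    intro ti y δ' hδ'
    set b₁ : AdeleRing (𝓞 F) F := (((ti, y) : AdeleRing (𝓞 F) F)) with hb₁
    set b₂ : AdeleRing (𝓞 F) F := ((((0 : InfiniteAdeleRing F), δ') : AdeleRing (𝓞 F) F)) with hb₂
    have hsplit : (((ti, y + δ') : AdeleRing (𝓞 F) F)) = b₁ + b₂ := Prod.ext (add_zero _).symm rfl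
    have hn : ∀ x : AdeleRing (𝓞 E) E, (uA x)⁻¹ * ((γ₀ : (quasiSplit F E c 3).Adelic) * nA ((traceZeroLine F E c hcδ hδ) (((ti, y + δ') : AdeleRing (𝓞 F) F)))) * uA x =
        ((uA x)⁻¹ * ((γ₀ : (quasiSplit F E c 3).Adelic) * nA ((traceZeroLine F E c hcδ hδ) (((ti, y) : AdeleRing (𝓞 F) F)))) * uA x) *
          nA ((traceZeroLine F E c hcδ hδ) ((((0 : InfiniteAdeleRing F), δ') : AdeleRing (𝓞 F) F))) := by
      intro x
      have hmul : nA ((traceZeroLine F E c hcδ hδ) (((ti, y + δ') : AdeleRing (𝓞 F) F))) =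
          nA ((traceZeroLine F E c hcδ hδ) b₁) * nA ((traceZeroLine F E c hcδ hδ) b₂) := by
        rw [hsplit, map_add]
        show ((heisChart hc ((0 : AdeleRing (𝓞 E) E), (traceZeroLine F E c hcδ hδ) b₁ + (traceZeroLine F E c hcδ hδ) b₂) :
            adelicUnipotent F E c 3) : (quasiSplit F E c 3).Adelic) =
          ((heisChart hc ((0 : AdeleRing (𝓞 E) E), (traceZeroLine F E c hcδ hδ) b₁) : adelicUnipotent F E c 3) :
              (quasiSplit F E c 3).Adelic) *
            ((heisChart hc ((0 : AdeleRing (𝓞 E) E), (traceZeroLine F E c hcδ hδ) b₂) : adelicUnipotent F E c 3) :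
              (quasiSplit F E c 3).Adelic)
        rw [← Subgroup.coe_mul, heisChart_zero_mul hc]
      have hcomm : Commute (nA ((traceZeroLine F E c hcδ hδ) ((((0 : InfiniteAdeleRing F), δ') : AdeleRing (𝓞 F) F)))) (uA x) :=
        commute_center_coe_unipotentInBorel hc _ _
      rw [hmul]
      calc (uA x)⁻¹ * ((γ₀ : (quasiSplit F E c 3).Adelic) * (nA ((traceZeroLine F E c hcδ hδ) (((ti, y) : AdeleRing (𝓞 F) F))) *
              nA ((traceZeroLine F E c hcδ hδ) ((((0 : InfiniteAdeleRing F), δ') : AdeleRing (𝓞 F) F))))) * uA x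
          = (uA x)⁻¹ * ((γ₀ : (quasiSplit F E c 3).Adelic) * nA ((traceZeroLine F E c hcδ hδ) (((ti, y) : AdeleRing (𝓞 F) F)))) *
              (nA ((traceZeroLine F E c hcδ hδ) ((((0 : InfiniteAdeleRing F), δ') : AdeleRing (𝓞 F) F))) * uA x) := by group
        _ = (uA x)⁻¹ * ((γ₀ : (quasiSplit F E c 3).Adelic) * nA ((traceZeroLine F E c hcδ hδ) (((ti, y) : AdeleRing (𝓞 F) F)))) *
              (uA x * nA ((traceZeroLine F E c hcδ hδ) ((((0 : InfiniteAdeleRing F), δ') : AdeleRing (𝓞 F) F)))) := by rw [hcomm.eq]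
        _ = _ := by group
    show (∫ x : AdeleRing (𝓞 E) E, (∫ k, f ((k : (quasiSplit F E c 3).Adelic)⁻¹ *
        ((uA x)⁻¹ * ((γ₀ : (quasiSplit F E c 3).Adelic) * nA ((traceZeroLine F E c hcδ hδ) (((ti, y + δ') : AdeleRing (𝓞 F) F)))) * uA x) * k) ∂μK) ∂μX) =
      ∫ x : AdeleRing (𝓞 E) E, (∫ k, f ((k : (quasiSplit F E c 3).Adelic)⁻¹ *
        ((uA x)⁻¹ * ((γ₀ : (quasiSplit F E c 3).Adelic) * nA ((traceZeroLine F E c hcδ hδ) (((ti, y) : AdeleRing (𝓞 F) F)))) * uA x) * k) ∂μK) ∂μX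
    simp_rw [hn, hlevel δ' hδ']
  -- assemble Weil's criterion on `𝔸_F`
  refine Meyer.mem_schwartzBruhatAdele_of_level (hTc.image continuous_snd) (fun t ht => ⟨t, hΨ0 t ht, rfl⟩)
    (isOpen_levelIdeal 𝔫) (isCompact_levelIdeal 𝔫) hinv hsm (fun y => ?_)
  refine HasCompactSupport.of_support_subset_isCompact
    ((hTc.image continuous_fst).image (continuous_ringEquiv_mixedSpace (K := F))) fun s hs => ?_
  have ht : ((((InfiniteAdeleRing.ringEquiv_mixedSpace F).symm s, y) : AdeleRing (𝓞 F) F)) ∈ (traceZeroLine F E c hcδ hδ).symm '' W_c := hΨ0 _ hs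
  exact ⟨(InfiniteAdeleRing.ringEquiv_mixedSpace F).symm s, ⟨_, ht, rfl⟩, (InfiniteAdeleRing.ringEquiv_mixedSpace F).apply_symm_apply s⟩

/-- **FUBINI FOR THE SINGULAR LINE FUNCTION**: for every `t`, `∫_{𝔸_E} ∫_K … dμK dμX = ∫_K ∫_{𝔸_E} … dμX dμK` (`= ∫_K ψ_k(θ t) dμK` with
`ψ_k(w) := ∫_{𝔸_E} f(k⁻¹ (u(x)⁻¹ (γ₀ n(w)) u(x)) k) dμX`): the integrand is continuous of compact support on `𝔸_E × K`.
[cite: Rogawski1990, §7.2 (pp. 94–95)] -/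
theorem integral_integral_singularLine_kAverage_swap (hc : c * c = 1) (hcδ : c δ = -δ) (hδ : δ ≠ 0) {a b : Eˣ}
    (hab : (a : E) ≠ (b : E)) {g₀ : (quasiSplit F E c 3).Rational} {γ₀ : (quasiSplit F E c 3).arithmeticSubgroup}
    (hg₀ : ((g₀.val : GL (Fin 3) E) : Matrix (Fin 3) (Fin 3) E) = !![(a : E), 0, 0; 0, b, 0; 0, 0, a])
    (hγ₀ : (γ₀ : (quasiSplit F E c 3).Adelic) = (quasiSplit F E c 3).toAdelic g₀)
    (μX : Measure (AdeleRing (𝓞 E) E)) [μX.IsAddHaarMeasure] (hK : IsCompact (KU : Set (quasiSplit F E c 3).Adelic))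
    (μK : Measure KU) [IsFiniteMeasure μK] {f : (quasiSplit F E c 3).Adelic → ℂ} (hf : IsQuasiSplitTest F E c 3 f)
    (t : AdeleRing (𝓞 F) F) :
    (∫ x : AdeleRing (𝓞 E) E, (∫ k, f ((k : (quasiSplit F E c 3).Adelic)⁻¹ *
        ((((heisElt hc x (0 : traceZeroAdele F E c) : unipotentInBorel F E c 3) : borelAdelic F E c 3) :
              (quasiSplit F E c 3).Adelic)⁻¹ *
          ((γ₀ : (quasiSplit F E c 3).Adelic) *
            (((heisElt hc 0 (traceZeroLine F E c hcδ hδ t) : unipotentInBorel F E c 3) : borelAdelic F E c 3) :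
              (quasiSplit F E c 3).Adelic)) *
          (((heisElt hc x (0 : traceZeroAdele F E c) : unipotentInBorel F E c 3) : borelAdelic F E c 3) :
              (quasiSplit F E c 3).Adelic)) * k) ∂μK) ∂μX) =
      ∫ k, (∫ x : AdeleRing (𝓞 E) E, f ((k : (quasiSplit F E c 3).Adelic)⁻¹ *
        ((((heisElt hc x (0 : traceZeroAdele F E c) : unipotentInBorel F E c 3) : borelAdelic F E c 3) :
              (quasiSplit F E c 3).Adelic)⁻¹ *
          ((γ₀ : (quasiSplit F E c 3).Adelic) *
            (((heisElt hc 0 (traceZeroLine F E c hcδ hδ t) : unipotentInBorel F E c 3) : borelAdelic F E c 3) :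
              (quasiSplit F E c 3).Adelic)) *
          (((heisElt hc x (0 : traceZeroAdele F E c) : unipotentInBorel F E c 3) : borelAdelic F E c 3) :
              (quasiSplit F E c 3).Adelic)) * k) ∂μX) ∂μK := by
  haveI : T2Space (AdeleRing (𝓞 E) E) := t2Space_adeleRing E
  haveI : LocallyCompactSpace (AdeleRing (𝓞 E) E) := locallyCompactSpace_adeleRing' E
  haveI : SecondCountableTopology (AdeleRing (𝓞 E) E) := secondCountableTopology_adeleRing E
  haveI : SecondCountableTopology (GL (Fin 3) (AdeleRing (𝓞 E) E)) := secondCountableTopology_generalLinearGroup_adeleRing E (Fin 3)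
  haveI : SecondCountableTopology (quasiSplit F E c 3).Adelic :=
    inferInstanceAs (SecondCountableTopology (adelic F E c 3 ((StdForm.antidiagonal 3).over E)))
  haveI : SecondCountableTopology KU := TopologicalSpace.Subtype.secondCountableTopology _
  haveI : CompactSpace KU := isCompact_iff_compactSpace.1 hK
  have hfc : HasCompactSupport f := hf.hasCompactSupport'
  have hfcont : Continuous f := hf.continuous'
  set uA : AdeleRing (𝓞 E) E → (quasiSplit F E c 3).Adelic := fun x =>
    (((heisElt hc x (0 : traceZeroAdele F E c) : unipotentInBorel F E c 3) : borelAdelic F E c 3) : (quasiSplit F E c 3).Adelic)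
    with huA
  set nA : traceZeroAdele F E c → (quasiSplit F E c 3).Adelic := fun w =>
    (((heisElt hc 0 w : unipotentInBorel F E c 3) : borelAdelic F E c 3) : (quasiSplit F E c 3).Adelic) with hnA
  have huA' : uA = fun x => ((heisChart hc (x, (0 : traceZeroAdele F E c)) : adelicUnipotent F E c 3) : (quasiSplit F E c 3).Adelic) :=
    funext fun x => (coe_heisChart hc (x, (0 : traceZeroAdele F E c))).symm
  have huAc : Continuous uA := by
    rw [huA']
    exact continuous_subtype_val.comp ((heisChart hc).continuous.comp (continuous_id.prodMk continuous_const))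
  obtain ⟨X_c, hX_c, W_c, -, hXW⟩ := exists_isCompact_singularKernel_conj_support hc hab hg₀ hγ₀ hK hfc
  set w₀ := traceZeroLine F E c hcδ hδ t with hw₀
  have hcont : Continuous fun p : AdeleRing (𝓞 E) E × KU => f ((p.2 : (quasiSplit F E c 3).Adelic)⁻¹ *
      ((uA p.1)⁻¹ * ((γ₀ : (quasiSplit F E c 3).Adelic) * nA w₀) * uA p.1) * (p.2 : (quasiSplit F E c 3).Adelic)) :=
    hfcont.comp (((continuous_subtype_val.comp continuous_snd).inv.mul ((((huAc.comp continuous_fst).inv).mul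
      continuous_const).mul (huAc.comp continuous_fst))).mul (continuous_subtype_val.comp continuous_snd))
  have hsupp : HasCompactSupport fun p : AdeleRing (𝓞 E) E × KU => f ((p.2 : (quasiSplit F E c 3).Adelic)⁻¹ *
      ((uA p.1)⁻¹ * ((γ₀ : (quasiSplit F E c 3).Adelic) * nA w₀) * uA p.1) * (p.2 : (quasiSplit F E c 3).Adelic)) := by
    refine HasCompactSupport.intro (hX_c.prod isCompact_univ) fun p hp => ?_
    by_contra hne
    exact hp ⟨(hXW p.2 p.2.2 p.1 w₀ hne).1, mem_univ _⟩
  exact integral_integral_swap (hcont.integrable_of_hasCompactSupport hsupp)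

/-- **`ψ^K ∘ θ ∈ 𝒮(𝔸_F)` with the `K`-integral OUTSIDE** (`t ↦ ∫_K ψ_k(θ t) dμK`, the order in which the (c5) assembly of the singular
term arrives): the same function by Fubini (`integral_integral_singularLine_kAverage_swap`). [cite: Rogawski1990, §7.2 (pp. 94–95)] -/
theorem singularLine_kAverage_mem_schwartzBruhatAdele' (hc : c * c = 1) (hcδ : c δ = -δ) (hδ : δ ≠ 0) {a b : Eˣ}
    (hab : (a : E) ≠ (b : E)) {g₀ : (quasiSplit F E c 3).Rational} {γ₀ : (quasiSplit F E c 3).arithmeticSubgroup}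
    (hg₀ : ((g₀.val : GL (Fin 3) E) : Matrix (Fin 3) (Fin 3) E) = !![(a : E), 0, 0; 0, b, 0; 0, 0, a])
    (hγ₀ : (γ₀ : (quasiSplit F E c 3).Adelic) = (quasiSplit F E c 3).toAdelic g₀)
    (μX : Measure (AdeleRing (𝓞 E) E)) [μX.IsAddHaarMeasure] (hK : IsCompact (KU : Set (quasiSplit F E c 3).Adelic))
    (μK : Measure KU) [IsFiniteMeasure μK] {f : (quasiSplit F E c 3).Adelic → ℂ} (hf : IsQuasiSplitTest F E c 3 f) :
    (fun t : AdeleRing (𝓞 F) F =>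
      ∫ k, (∫ x : AdeleRing (𝓞 E) E, f ((k : (quasiSplit F E c 3).Adelic)⁻¹ *
        ((((heisElt hc x (0 : traceZeroAdele F E c) : unipotentInBorel F E c 3) : borelAdelic F E c 3) :
              (quasiSplit F E c 3).Adelic)⁻¹ *
          ((γ₀ : (quasiSplit F E c 3).Adelic) *
            (((heisElt hc 0 (traceZeroLine F E c hcδ hδ t) : unipotentInBorel F E c 3) : borelAdelic F E c 3) :
              (quasiSplit F E c 3).Adelic)) *
          (((heisElt hc x (0 : traceZeroAdele F E c) : unipotentInBorel F E c 3) : borelAdelic F E c 3) :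
              (quasiSplit F E c 3).Adelic)) * k) ∂μX) ∂μK) ∈ Meyer.schwartzBruhatAdele F := by
  have h := singularLine_kAverage_mem_schwartzBruhatAdele hc hcδ hδ hab hg₀ hγ₀ μX hK μK hf
  have heq : (fun t : AdeleRing (𝓞 F) F =>
      ∫ k, (∫ x : AdeleRing (𝓞 E) E, f ((k : (quasiSplit F E c 3).Adelic)⁻¹ *
        ((((heisElt hc x (0 : traceZeroAdele F E c) : unipotentInBorel F E c 3) : borelAdelic F E c 3) :
              (quasiSplit F E c 3).Adelic)⁻¹ *
          ((γ₀ : (quasiSplit F E c 3).Adelic) *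
            (((heisElt hc 0 (traceZeroLine F E c hcδ hδ t) : unipotentInBorel F E c 3) : borelAdelic F E c 3) :
              (quasiSplit F E c 3).Adelic)) *
          (((heisElt hc x (0 : traceZeroAdele F E c) : unipotentInBorel F E c 3) : borelAdelic F E c 3) :
              (quasiSplit F E c 3).Adelic)) * k) ∂μX) ∂μK) =
      fun t : AdeleRing (𝓞 F) F =>
      ∫ x : AdeleRing (𝓞 E) E, (∫ k, f ((k : (quasiSplit F E c 3).Adelic)⁻¹ *
        ((((heisElt hc x (0 : traceZeroAdele F E c) : unipotentInBorel F E c 3) : borelAdelic F E c 3) :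
              (quasiSplit F E c 3).Adelic)⁻¹ *
          ((γ₀ : (quasiSplit F E c 3).Adelic) *
            (((heisElt hc 0 (traceZeroLine F E c hcδ hδ t) : unipotentInBorel F E c 3) : borelAdelic F E c 3) :
              (quasiSplit F E c 3).Adelic)) *
          (((heisElt hc x (0 : traceZeroAdele F E c) : unipotentInBorel F E c 3) : borelAdelic F E c 3) :
              (quasiSplit F E c 3).Adelic)) * k) ∂μK) ∂μX :=
    funext fun t => (integral_integral_singularLine_kAverage_swap hc hcδ hδ hab hg₀ hγ₀ μX hK μK hf t).symm
  rw [heq]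
  exact h

end Assembly

end UnitaryGroup

end Literature.NumberTheory.Automorphic
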